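/-
Copyright (c) 2026 the pub-hodgecm-mathlib formalisation cell (harness21).  Prover seat hodgecm-mathlib-K2Liu-p13 (g4), Track B «K2-LIT»,
#184♮ = hLiu418 = `stmt-HodgeConjecture-24832`; ROAD Φ (RULING «M-156n»), #41 TOP — brick (E7) of the (β) census `CENSUS-Beta-EulerFace.K2Liu-p13-g4.md` (LEAD BATCH #53 (2)):
THE JUNCTION between the LOCAL normaliser `aNorm 2 χ_v vol s` of ★ A7 (`K2LiuLocalLFactorDefs`, the scalar in ★ A7-AllS0's `M_v(s) f = aNorm · Fn`) and the GLOBAL Gindikin–Karpelevich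
scalar `c_v(s)` of ★ O41.6 `hasProd_localScalar` ∕ ★ p861784 `invScalar_eq_finsetProd_mul`: at a place `v` of `F` unramified in `E` with unramified local characters,
`aNorm 2 χ_v vol s = vol · c_v(s)` in Satake-parameter currency, and — under parity `χ|_{𝕀_F} = ε_{E∕F}` — in `ε.valueAtUniformizer v` ∕ `v.residueCard` currency.
THEOREMS ONLY (no `def`, no `instance`, no named-fact hypothesis, no `sorry`).
-/
import Summits.HodgeConjecture.HodgeConjecture.Theorems.K2LiuGoodPlaceWhittakerUnimodularValueCM   -- ★ E7 `lEN_eq_of_split∕_inert`, `residueCard_*`, ★ `aNum_two`∕`bDen_two`, ★ `unramValue_chiF_eq_prod`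
import Summits.HodgeConjecture.HodgeConjecture.Theorems.K2E1HeckeCharBaseChangeLocalComponentsU     -- ★ J1a-dict `valueAtUniformizer_eq_prod_of_comp_ideleBaseChange`
import Summits.HodgeConjecture.HodgeConjecture.Theorems.K2E1QuadraticHeckeCharCMPlaceValues         -- ★ `valueAtUniformizer_quadraticHeckeCharCM_of_nonsplit∕_of_split`
import HarnessLib

/-!
# Crux `HLiu418`, ROAD Φ, organ Φ8 (row G6), brick (E7): THE `n = 2` SIEGEL NORMALISER `aNorm 2` AT AN UNRAMIFIED PLACE, IN GLOBAL CURRENCY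

Cell `hodgecm-mathlib`, crux item hLiu418 = `stmt-HodgeConjecture-24832` (helper lane, count-neutral).  Quadratic `E∕F` with involution `c` (`c δ = −δ`, `δ ≠ 0`), a finite place `v`
of `F` UNRAMIFIED in `E` (`ϖ` a uniformizer of `F_v` with `ι_w ϖ` a uniformizer of `E_w` for every `w ∣ v`), local characters `χ_w` of `E_wˣ` unramified for `w ∣ v`, Satake value
`α := ∏_{w∣v} χ_w(ι_w ϖ)` of `χ_{F,v}` (★ `unramValue_chiF_eq_prod`), `q := v.residueCard` (★ `residueFieldCard_adicCompletion_eq`).  The normaliser of ★ A7 is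
`aNorm 2 χ_v vol s = vol · [L_F(2s−1,χ_F)·L_{E∕F}(2s,χ_F∘N)∕L_F(2s,χ_F)] ∕ [L_F(2s+2,χ_F)·L_{E∕F}(2s+1,χ_F∘N)∕L_F(2s+1,χ_F)]` (★ `aNum_two`, ★ `bDen_two`); with ★ E7's closed forms
of `L_{E∕F}` (`lEN_eq_of_split`: `(1−αq^{−z})^{−2}`; `lEN_eq_of_inert`: `(1−α²q^{−2z})⁻¹`) and `L_F(z,χ_F) = (1−αq^{−z})⁻¹`:
* §2 **`aNorm_two_eq_of_split`** — `aNorm 2 χ_v vol s = vol·(1−αq^{−(2s+2)})(1−αq^{−(2s+1)}) ∕ ((1−αq^{−(2s−1)})(1−αq^{−2s}))` (no side condition);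
* §3 **`aNorm_two_eq_of_inert`** — `aNorm 2 χ_v vol s = vol·(1−αq^{−(2s+2)})(1+αq^{−(2s+1)}) ∕ ((1−αq^{−(2s−1)})(1+αq^{−2s}))` off the lines `αq^{−2s} = 1`, `αq^{−(2s+1)} = 1`
  (where Lean's junk `x∕0 = 0` differs; empty for unitary `χ` on `re s > 0`);
* §4 PARITY `α = η_v(ϖ)` (`+1` split, `−1` inert): **`aNorm_two_eq_localScalar_of_split∕_of_inert`** — `aNorm 2 χ_v vol s = vol · [(1−q^{−(2s+1)})(1−α q^{−(2s+2)})]∕[(1−q^{−2s})(1−α q^{−(2s−1)})]`,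
  ★ O41.6 `hasProd_localScalar`'s factor BYTE FOR BYTE with `α` for `ε.valueAtUniformizer v`;
* §5 THE K2_Liu FRAME: for a Hecke character `χ` of the CM field `L` with `χ|_{𝕀_{L⁺}} = ε_{L∕L⁺}` (★ J1a-dict's hypothesis shape), `χ_w` unramified above `v`, `v` unramified in `L`,
  `0 < re s`: **`aNorm_two_localComponent_eq_localScalar_cm`** — `aNorm 2 (χ_w)_{w∣v} vol s = vol · [(1−q_v^{−(2s+1)})(1−ε(ϖ_v)q_v^{−(2s+2)})]∕[(1−q_v^{−2s})(1−ε(ϖ_v)q_v^{−(2s−1)})]`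
  (`ε = quadraticHeckeCharCM L`; `α = ε(ϖ_v)` ★ `valueAtUniformizer_eq_prod_of_comp_ideleBaseChange`, `= ∓1` ★ `valueAtUniformizer_quadraticHeckeCharCM_of_nonsplit∕_of_split`).
USE ((β) census (E5)+(E7)): at an `ε`-unramified bad place `v ∈ P` the `c_v⁻¹` of ★ p861784 cancels `aNorm_v∕vol_v` EXACTLY, so ★ A7-AllS0's `Fn` enters ★ `exists_bigCell_continuation_of_faces`
with `c κ v := vol_v`; at the good places the spherical value (E4) `= aNorm_v` joins ★ `hasProd_localScalar`.  NOT HERE (E7′): places where some `χ_w` is RAMIFIED but `χ_{F,v}` is not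
(`a_w` depends on `χ_F` only — needs the norm-twist value without `hχur`), and the `ε`-ramified places (`lF = 1`, `lEN = ζ_{F_v}`: `aNorm = vol·(1−q^{−(2s+1)})∕(1−q^{−2s})`).
Sources: [HarrisKudlaSweet1996, §6 (6.14)–(6.16)]; [KudlaSweet1997, §1]; [Liu2011, §2A (2-2)]; [Harris2007, (1.3.4) p. 92]; [CasselsFrohlichANT1967, Ch. II §11, Ch. VII Prop. 1.2].
HONEST LABEL.  Helper lemmas, count-neutral; `HC_CM` is proved only modulo the 7 printed citations (2 remaining named inputs:
hLiu418 = `stmt-HodgeConjecture-24832`, h413 = `stmt-HodgeConjecture-24833`) until rung 0 closes.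
-/

set_option autoImplicit false
-- the mandated namespace repeats the single-problem summit's segment (`HodgeConjecture.HodgeConjecture`)
set_option linter.dupNamespace false

noncomputable section

open scoped NNReal ENNReal Matrix Topology
open NumberField IsDedekindDomain Matrix MeasureTheory Set Filter
open Literature.NumberTheory.GaloisRepresentations Literature.NumberTheory.GaloisRepresentations.IsNonarchimedeanLocalField
open Literature.NumberTheory.Automorphic Literature.NumberTheory.Automorphic.UnitaryGroup
open Literature.NumberTheory.GelbartRogawski1991.AdaptedBlocks
open Literature.NumberTheory.GelbartRogawski1991.UnitaryDualPair.LocalSplitting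
open Literature.NumberTheory.K2Lit.LocalSiegelDoubled
open Summit.HodgeConjecture.HodgeConjecture.Cruxes.HLiu418.K2LiuLocalLFactorDefs
open Summit.HodgeConjecture.HodgeConjecture.Cruxes.HLiu418.K2LiuGKRankOneIdentityLFactor
open Summit.HodgeConjecture.HodgeConjecture.Cruxes.HLiu418.K2LiuA7NormaliserAlgebra
open Summit.HodgeConjecture.HodgeConjecture.Cruxes.HLiu418.K2LiuGoodPlaceWhittakerUnimodularValueCM
open Summit.HodgeConjecture.HodgeConjecture.Cruxes.H413.K2E1HeckeCharBaseChangeLocalComponentsU (valueAtUniformizer_eq_prod_of_comp_ideleBaseChange)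
open Summit.HodgeConjecture.HodgeConjecture.Cruxes.H413.K2E1QuadraticHeckeCharCMPlaceValues

namespace Summit.HodgeConjecture.HodgeConjecture.Cruxes.HLiu418.K2LiuSiegelNormaliserTwoValue

/-! ## §1 Two cancellations in a field (Lean's `0⁻¹ = 0` conventions respected) -/

/-- `(x⁻¹)² ∕ x⁻¹ = x⁻¹` (also at `x = 0`). [folklore] -/
theorem inv_sq_div_inv (x : ℂ) : (x⁻¹) ^ 2 / x⁻¹ = x⁻¹ := by
  rcases eq_or_ne x 0 with h | h
  · simp [h]
  · rw [sq, div_eq_mul_inv, inv_inv, mul_assoc, inv_mul_cancel₀ h, mul_one]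

/-- `(a b)⁻¹ ∕ a⁻¹ = b⁻¹` for `a ≠ 0` (also at `b = 0`). [folklore] -/
theorem mul_inv_div_inv {a : ℂ} (ha : a ≠ 0) (b : ℂ) : (a * b)⁻¹ / a⁻¹ = b⁻¹ := by
  rw [mul_inv, mul_div_cancel_left₀ _ (inv_ne_zero ha)]

/-- `(x⁻¹ y⁻¹) ∕ (u⁻¹ w⁻¹) = (u w) ∕ (x y)`, unconditionally. [folklore] -/
theorem inv_mul_inv_div (x y u w : ℂ) : (x⁻¹ * y⁻¹) / (u⁻¹ * w⁻¹) = (u * w) / (x * y) := by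
  simp only [div_eq_mul_inv, mul_inv, inv_inv]
  ring

section Quadratic

variable (F : Type) [Field F] [NumberField F] (E : Type) [Field E] [NumberField E] [Algebra F E]
  [Algebra.IsQuadraticExtension F E] (c : E ≃ₐ[F] E) {δ : E} (hcδ : c δ = -δ) (hδ : δ ≠ 0)
  (v : HeightOneSpectrum (𝓞 F))
  {π : v.adicCompletion F} (hπ : Valued.v π = WithZero.exp (-1 : ℤ)) (hπw : ∀ w : PlacesOver E v, Valued.v (toPlace v w π) = WithZero.exp (-1 : ℤ))

/-! ## §2 The split place -/

include hπ hπw in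
/-- **SPLIT `v`: `aNorm 2 χ_v vol s = vol·(1−αq^{−(2s+2)})(1−αq^{−(2s+1)}) ∕ ((1−αq^{−(2s−1)})(1−αq^{−2s}))`**, `α = ∏_{w∣v}χ_w(ι_wϖ)`, `q = q_v` — NO side condition
(★ `aNum_two`∕`bDen_two`, ★ E7 `lEN_eq_of_split`, `L_F(z,χ_F) = (1−αq^{−z})⁻¹`). [cite: HarrisKudlaSweet1996, §6 (6.16)] [cite: Liu2011, §2A (2-2)] -/
theorem aNorm_two_eq_of_split {χv : ∀ w : PlacesOver E v, (w.1.adicCompletion E)ˣ →* ℂˣ}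
    (hχur : ∀ (w : PlacesOver E v) (x : (w.1.adicCompletion E)ˣ), Valued.v (x : w.1.adicCompletion E) = 1 → χv w x = 1)
    (hϖ0 : ∀ w : PlacesOver E v, toPlace v w π ≠ 0) (w₀ : PlacesOver E v) (hw₀ : c • w₀.1 ≠ w₀.1) (vol : ℝ) (s : ℂ) :
    aNorm F E c v 2 χv vol s = (vol : ℂ) *
      (((1 - (((∏ w : PlacesOver E v, χv w (Units.mk0 (toPlace v w π) (hϖ0 w))) : ℂˣ) : ℂ) * (v.residueCard : ℂ) ^ (-(2 * s + 2))) *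
          (1 - (((∏ w : PlacesOver E v, χv w (Units.mk0 (toPlace v w π) (hϖ0 w))) : ℂˣ) : ℂ) * (v.residueCard : ℂ) ^ (-(2 * s + 1)))) /
        ((1 - (((∏ w : PlacesOver E v, χv w (Units.mk0 (toPlace v w π) (hϖ0 w))) : ℂˣ) : ℂ) * (v.residueCard : ℂ) ^ (-(2 * s - 1))) *
          (1 - (((∏ w : PlacesOver E v, χv w (Units.mk0 (toPlace v w π) (hϖ0 w))) : ℂˣ) : ℂ) * (v.residueCard : ℂ) ^ (-(2 * s))))) := by
  rw [aNorm_def, aNum_two, bDen_two, lEN_eq_of_split F E c v hπw hχur hϖ0 w₀ hw₀ (2 * s), lEN_eq_of_split F E c v hπw hχur hϖ0 w₀ hw₀ (2 * s + 1)]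
  simp only [lF, lFactor_def]
  rw [unramValue_chiF_eq_prod F E v χv hχur hπ hϖ0, residueFieldCard_adicCompletion_eq F v, inv_sq_div_inv, inv_sq_div_inv, inv_mul_inv_div]

/-! ## §3 The inert place -/

include hcδ hδ hπ hπw in
/-- **INERT `v`: `aNorm 2 χ_v vol s = vol·(1−αq^{−(2s+2)})(1+αq^{−(2s+1)}) ∕ ((1−αq^{−(2s−1)})(1+αq^{−2s}))`**, OFF the lines `αq^{−2s} = 1`, `αq^{−(2s+1)} = 1`
(`L_{E∕F}(z)∕L_F(z) = (1−αq^{−z})∕(1−α²q^{−2z}) = (1+αq^{−z})⁻¹` there; ★ E7 `lEN_eq_of_inert`). [cite: HarrisKudlaSweet1996, §6 (6.16)] [cite: Liu2011, §2A (2-2)] -/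
theorem aNorm_two_eq_of_inert {χv : ∀ w : PlacesOver E v, (w.1.adicCompletion E)ˣ →* ℂˣ}
    (hχur : ∀ (w : PlacesOver E v) (x : (w.1.adicCompletion E)ˣ), Valued.v (x : w.1.adicCompletion E) = 1 → χv w x = 1)
    (hϖ0 : ∀ w : PlacesOver E v, toPlace v w π ≠ 0) (w₀ : PlacesOver E v) (hw₀ : c • w₀.1 = w₀.1) (vol : ℝ) (s : ℂ)
    (hB : 1 - (((∏ w : PlacesOver E v, χv w (Units.mk0 (toPlace v w π) (hϖ0 w))) : ℂˣ) : ℂ) * (v.residueCard : ℂ) ^ (-(2 * s)) ≠ 0)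
    (hD : 1 - (((∏ w : PlacesOver E v, χv w (Units.mk0 (toPlace v w π) (hϖ0 w))) : ℂˣ) : ℂ) * (v.residueCard : ℂ) ^ (-(2 * s + 1)) ≠ 0) :
    aNorm F E c v 2 χv vol s = (vol : ℂ) *
      (((1 - (((∏ w : PlacesOver E v, χv w (Units.mk0 (toPlace v w π) (hϖ0 w))) : ℂˣ) : ℂ) * (v.residueCard : ℂ) ^ (-(2 * s + 2))) *
          (1 + (((∏ w : PlacesOver E v, χv w (Units.mk0 (toPlace v w π) (hϖ0 w))) : ℂˣ) : ℂ) * (v.residueCard : ℂ) ^ (-(2 * s + 1)))) /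
        ((1 - (((∏ w : PlacesOver E v, χv w (Units.mk0 (toPlace v w π) (hϖ0 w))) : ℂˣ) : ℂ) * (v.residueCard : ℂ) ^ (-(2 * s - 1))) *
          (1 + (((∏ w : PlacesOver E v, χv w (Units.mk0 (toPlace v w π) (hϖ0 w))) : ℂˣ) : ℂ) * (v.residueCard : ℂ) ^ (-(2 * s))))) := by
  rw [aNorm_def, aNum_two, bDen_two, lEN_eq_of_inert F E c hcδ hδ v hπ hπw hχur hϖ0 w₀ hw₀ (2 * s),
    lEN_eq_of_inert F E c hcδ hδ v hπ hπw hχur hϖ0 w₀ hw₀ (2 * s + 1)]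
  simp only [lF, lFactor_def]
  rw [unramValue_chiF_eq_prod F E v χv hχur hπ hϖ0, residueFieldCard_adicCompletion_eq F v]
  set α : ℂ := (((∏ w : PlacesOver E v, χv w (Units.mk0 (toPlace v w π) (hϖ0 w))) : ℂˣ) : ℂ) with hα
  set q : ℂ := (v.residueCard : ℂ) with hq
  have h2 : 1 - α ^ 2 * (q ^ (-(2 * s)) * q ^ (-(2 * s))) = (1 - α * q ^ (-(2 * s))) * (1 + α * q ^ (-(2 * s))) := by ring
  have h3 : 1 - α ^ 2 * (q ^ (-(2 * s + 1)) * q ^ (-(2 * s + 1))) = (1 - α * q ^ (-(2 * s + 1))) * (1 + α * q ^ (-(2 * s + 1))) := by ring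
  rw [h2, h3, mul_inv_div_inv hB, mul_inv_div_inv hD, inv_mul_inv_div]

/-! ## §4 Parity: `α = +1` at a split place, `α = −1` at an inert place — ★ `hasProd_localScalar`'s factor -/

include hπ hπw in
/-- **SPLIT, PARITY `α = 1`**: `aNorm 2 χ_v vol s = vol·[(1−q^{−(2s+1)})(1−α q^{−(2s+2)})]∕[(1−q^{−2s})(1−α q^{−(2s−1)})]` — the local Gindikin–Karpelevich scalar `c_v(s)` of ★ O41.6
`hasProd_localScalar` with `α` (`= ε(ϖ_v) = 1`) in place of `ε.valueAtUniformizer v`. [cite: Harris2007, (1.3.4) p. 92] [cite: Liu2011, §2A (2-2)] -/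
theorem aNorm_two_eq_localScalar_of_split {χv : ∀ w : PlacesOver E v, (w.1.adicCompletion E)ˣ →* ℂˣ}
    (hχur : ∀ (w : PlacesOver E v) (x : (w.1.adicCompletion E)ˣ), Valued.v (x : w.1.adicCompletion E) = 1 → χv w x = 1)
    (hϖ0 : ∀ w : PlacesOver E v, toPlace v w π ≠ 0) (w₀ : PlacesOver E v) (hw₀ : c • w₀.1 ≠ w₀.1) (vol : ℝ) (s : ℂ)
    (hα : (((∏ w : PlacesOver E v, χv w (Units.mk0 (toPlace v w π) (hϖ0 w))) : ℂˣ) : ℂ) = 1) :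
    aNorm F E c v 2 χv vol s = (vol : ℂ) *
      (((1 - (v.residueCard : ℂ) ^ (-(2 * s + 1))) *
          (1 - (((∏ w : PlacesOver E v, χv w (Units.mk0 (toPlace v w π) (hϖ0 w))) : ℂˣ) : ℂ) * (v.residueCard : ℂ) ^ (-(2 * s + 2)))) /
        ((1 - (v.residueCard : ℂ) ^ (-(2 * s))) *
          (1 - (((∏ w : PlacesOver E v, χv w (Units.mk0 (toPlace v w π) (hϖ0 w))) : ℂˣ) : ℂ) * (v.residueCard : ℂ) ^ (-(2 * s - 1))))) := by
  rw [aNorm_two_eq_of_split F E c v hπ hπw hχur hϖ0 w₀ hw₀ vol s, hα]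
  simp only [one_mul]
  ring

include hcδ hδ hπ hπw in
/-- **INERT, PARITY `α = −1`, `0 < re s`**: `aNorm 2 χ_v vol s = vol·[(1−q^{−(2s+1)})(1−α q^{−(2s+2)})]∕[(1−q^{−2s})(1−α q^{−(2s−1)})]` — the same ★ `hasProd_localScalar` factor
(`α = ε(ϖ_v) = −1`); the side lines of §3 are empty on `re s > 0` (`‖q^{−2s}‖, ‖q^{−(2s+1)}‖ < 1`). [cite: Harris2007, (1.3.4) p. 92] [cite: Liu2011, §2A (2-2)] -/
theorem aNorm_two_eq_localScalar_of_inert {χv : ∀ w : PlacesOver E v, (w.1.adicCompletion E)ˣ →* ℂˣ}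
    (hχur : ∀ (w : PlacesOver E v) (x : (w.1.adicCompletion E)ˣ), Valued.v (x : w.1.adicCompletion E) = 1 → χv w x = 1)
    (hϖ0 : ∀ w : PlacesOver E v, toPlace v w π ≠ 0) (w₀ : PlacesOver E v) (hw₀ : c • w₀.1 = w₀.1) (vol : ℝ) {s : ℂ} (hs : 0 < s.re)
    (hα : (((∏ w : PlacesOver E v, χv w (Units.mk0 (toPlace v w π) (hϖ0 w))) : ℂˣ) : ℂ) = -1) :
    aNorm F E c v 2 χv vol s = (vol : ℂ) *
      (((1 - (v.residueCard : ℂ) ^ (-(2 * s + 1))) *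
          (1 - (((∏ w : PlacesOver E v, χv w (Units.mk0 (toPlace v w π) (hϖ0 w))) : ℂˣ) : ℂ) * (v.residueCard : ℂ) ^ (-(2 * s + 2)))) /
        ((1 - (v.residueCard : ℂ) ^ (-(2 * s))) *
          (1 - (((∏ w : PlacesOver E v, χv w (Units.mk0 (toPlace v w π) (hϖ0 w))) : ℂˣ) : ℂ) * (v.residueCard : ℂ) ^ (-(2 * s - 1))))) := by
  -- the side lines are empty: `‖q^{−z}‖ < 1` for `0 < re z` (★ `K2E1FiniteWhittakerInertU3.norm_natCast_cpow_neg_lt_one`, inlined)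
  have key : ∀ z : ℂ, 0 < z.re → (v.residueCard : ℂ) ^ (-z) ≠ -1 := fun z hz h => by
    have hlt : ‖(v.residueCard : ℂ) ^ (-z)‖ < 1 := by
      rw [Complex.norm_natCast_cpow_of_pos (lt_trans zero_lt_one v.one_lt_residueCard), Complex.neg_re]
      exact Real.rpow_lt_one_of_one_lt_of_neg (by exact_mod_cast v.one_lt_residueCard) (neg_lt_zero.2 hz)
    rw [h, norm_neg, norm_one] at hlt
    exact lt_irrefl _ hlt
  have hB : 1 - (((∏ w : PlacesOver E v, χv w (Units.mk0 (toPlace v w π) (hϖ0 w))) : ℂˣ) : ℂ) * (v.residueCard : ℂ) ^ (-(2 * s)) ≠ 0 := by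
    rw [hα, neg_one_mul, sub_neg_eq_add]
    intro h
    exact key (2 * s) (by simp [Complex.mul_re]; linarith) (eq_neg_of_add_eq_zero_right h)
  have hD : 1 - (((∏ w : PlacesOver E v, χv w (Units.mk0 (toPlace v w π) (hϖ0 w))) : ℂˣ) : ℂ) * (v.residueCard : ℂ) ^ (-(2 * s + 1)) ≠ 0 := by
    rw [hα, neg_one_mul, sub_neg_eq_add]
    intro h
    exact key (2 * s + 1) (by simp [Complex.mul_re, Complex.add_re]; linarith) (eq_neg_of_add_eq_zero_right h)
  rw [aNorm_two_eq_of_inert F E c hcδ hδ v hπ hπw hχur hϖ0 w₀ hw₀ vol s hB hD, hα]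
  simp only [neg_one_mul, sub_neg_eq_add]
  ring

end Quadratic

/-! ## §5 The K2_Liu frame: a Hecke character of the CM field `L` with `χ|_{𝕀_{L⁺}} = ε_{L∕L⁺}` -/

section CM

variable (L : Type) [Field L] [NumberField L] [IsCMField L]
  (v : HeightOneSpectrum (𝓞 ↥(maximalRealSubfield L)))
  {π : v.adicCompletion ↥(maximalRealSubfield L)} (hπ : Valued.v π = WithZero.exp (-1 : ℤ))
  (hπw : ∀ w : PlacesOver L v, Valued.v (toPlace v w π) = WithZero.exp (-1 : ℤ))

include hπ hπw in
/-- **THE JUNCTION AT THE K2_Liu FRAME.**  `L` CM, `c` = complex conjugation (`c δ = −δ` for `δ = imagUnit L`), `ε = ε_{L∕L⁺} =` ★ `quadraticHeckeCharCM L`, `χ` a Hecke character of `L`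
with `χ(a_L) = ε(a)` on `𝕀_{L⁺}` (parity, ★ J1a-dict's shape), `v` a finite place of `L⁺` unramified in `L` (`hunr`, and `ι_w ϖ` a uniformizer at every `w ∣ v`), `χ_w` unramified for
`w ∣ v`, `0 < re s`.  Then **`aNorm 2 (χ_w)_{w∣v} vol s = vol · [(1−q_v^{−(2s+1)})(1−ε(ϖ_v)q_v^{−(2s+2)})]∕[(1−q_v^{−2s})(1−ε(ϖ_v)q_v^{−(2s−1)})]`** — ★ O41.6 `hasProd_localScalar`'s local factor
at `v`, times the volume. [cite: HarrisKudlaSweet1996, §6 (6.14)–(6.16)] [cite: Harris2007, (1.3.4) p. 92] [cite: CasselsFrohlichANT1967, Ch. VII Prop. 1.2] -/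
theorem aNorm_two_localComponent_eq_localScalar_cm (χ : HeckeCharacter L)
    (hχε : ∀ a : ideleGroup ↥(maximalRealSubfield L), χ (AdeleRing.ideleBaseChange ↥(maximalRealSubfield L) L a) = quadraticHeckeCharCM L a)
    (hχur : ∀ (w : PlacesOver L v) (u : (w.1.adicCompletion L)ˣ), Valued.v (u : w.1.adicCompletion L) = 1 → χ.localComponent w.1 u = 1)
    (hunr : Algebra.IsUnramifiedIn (𝓞 L) v.asIdeal) (w₀ : PlacesOver L v) (vol : ℝ) {s : ℂ} (hs : 0 < s.re) :
    aNorm ↥(maximalRealSubfield L) L (IsCMField.complexConj L : L ≃ₐ[↥(maximalRealSubfield L)] L) v 2 (fun w : PlacesOver L v => χ.localComponent w.1) vol s =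
      (vol : ℂ) *
        (((1 - (v.residueCard : ℂ) ^ (-(2 * s + 1))) * (1 - (quadraticHeckeCharCM L).valueAtUniformizer v * (v.residueCard : ℂ) ^ (-(2 * s + 2)))) /
          ((1 - (v.residueCard : ℂ) ^ (-(2 * s))) * (1 - (quadraticHeckeCharCM L).valueAtUniformizer v * (v.residueCard : ℂ) ^ (-(2 * s - 1))))) := by
  haveI : Algebra.IsQuadraticExtension ↥(maximalRealSubfield L) L := IsCMField.isQuadraticExtension L
  have hϖ0 : ∀ w : PlacesOver L v, toPlace v w π ≠ 0 := fun w h0 => by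
    have h1 := hπw w
    rw [h0, map_zero] at h1
    exact WithZero.zero_ne_coe h1
  have hαε : (((∏ w : PlacesOver L v, χ.localComponent w.1 (Units.mk0 (toPlace v w π) (hϖ0 w))) : ℂˣ) : ℂ) =
      (quadraticHeckeCharCM L).valueAtUniformizer v :=
    (valueAtUniformizer_eq_prod_of_comp_ideleBaseChange χ (quadraticHeckeCharCM L) hχε v hχur hπ hϖ0).symm
  by_cases hw₀ : (IsCMField.complexConj L : L ≃ₐ[↥(maximalRealSubfield L)] L) • w₀.1 = w₀.1
  · -- inert: `ε(ϖ_v) = −1`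
    have hval : (quadraticHeckeCharCM L).valueAtUniformizer v = -1 := valueAtUniformizer_quadraticHeckeCharCM_of_nonsplit L v w₀ hw₀ hunr
    rw [aNorm_two_eq_localScalar_of_inert ↥(maximalRealSubfield L) L (IsCMField.complexConj L) (Literature.NumberTheory.GelbartRogawski1991.UnitaryDualPair.complexConj_imagUnit L)
      (Literature.NumberTheory.GelbartRogawski1991.UnitaryDualPair.imagUnit_ne_zero L) v hπ hπw hχur hϖ0 w₀ hw₀ vol hs (hαε.trans hval), hαε]
  · -- split: `ε(ϖ_v) = 1`
    have hval : (quadraticHeckeCharCM L).valueAtUniformizer v = 1 := valueAtUniformizer_quadraticHeckeCharCM_of_split L v w₀ hw₀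
    rw [aNorm_two_eq_localScalar_of_split ↥(maximalRealSubfield L) L (IsCMField.complexConj L) v hπ hπw hχur hϖ0 w₀ hw₀ vol s (hαε.trans hval), hαε]

end CM

end Summit.HodgeConjecture.HodgeConjecture.Cruxes.HLiu418.K2LiuSiegelNormaliserTwoValue

end
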